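import Mathlib.Analysis.SpecialFunctions.Log.NegMulLog
import Mathlib.Analysis.SpecialFunctions.SmoothTransition
import Mathlib.Analysis.SpecialFunctions.Pow.Real
import Mathlib.Analysis.SpecialFunctions.Sqrt
import Mathlib.Analysis.Calculus.Deriv.MeanValue
import Mathlib.MeasureTheory.Integral.IntervalIntegral.FundThmCalculus
import Mathlib.Analysis.Calculus.ContDiff.Deriv
import Mathlib.MeasureTheory.Integral.DominatedConvergence
import Mathlib.Analysis.Normed.Lp.SmoothApprox
import Mathlib.Analysis.Calculus.BumpFunction.FiniteDimension
import HarnessLib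

/-!
# Lemmas for the approximation of DiPerna–Lions data

Topic: MathematicalPhysics / KineticTheory (elementary real analysis and measure theory used in
the proof of `Literature.MathematicalPhysics.KineticTheory.data_approximation`, CIP 1994 §5.3
Step 7: "we approximate `f₀` in `L¹₊` by a sequence `{f₀ⁿ} ⊂ 𝒮` such that
`∫ f₀ⁿ (1 + |x|² + |ξ|²) → ∫ f₀ (1 + |x|² + |ξ|²)`, `∫ f₀ⁿ |ln f₀ⁿ| → ∫ f₀ |ln f₀|`", asserted
there without proof). Everything here is proved; the file declares theorems only.

* The two halves of the entropy function: `P(u) = u log⁺ u = u · max (log u) 0` and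
  `N(u) = u log⁻ u = u · max (-log u) 0`, with `u log u = P - N`, `u |log u| = P + N`
  (`mul_log_eq_posPart_sub_negPart`, `mul_abs_log_eq_posPart_add_negPart`); the **Lipschitz
  estimate** `|P a - P b| ≤ (1 + log M) |a - b|` on `[0, M]` (`abs_posPart_entropy_sub_le`) and
  the **Hölder estimate** `|N a - N b| ≤ 4 √|a - b|` on `[0, ∞)` (`abs_negPart_entropy_sub_le`),
  both by monotonicity arguments (`monotoneOn_of_deriv_nonneg`) for `u log u`,
  `(1 + log M) u - u log u`, `4√u ± u log u`.
* `exists_smooth_clamp`: a smooth `1`-Lipschitz `σ : ℝ → ℝ`, `0 ≤ σ ≤ M + 1`, vanishing on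
  `(-∞, a/2]`, with `|σ u - u| ≤ a` on `[0, M]` (a primitive of `Real.smoothTransition` products).
* Truncations `T = min(F, n) 1_K` of a nonnegative function: elementary bounds
  (`truncation_mem`, `truncation_cases`), eventual stationarity along an exhausting family
  (`eventually_truncation_eq`), the dominated-convergence lemma for eventually stationary
  sequences (`tendsto_integral_abs_sub_of_eventually_eq`), and the dominations
  `|P(T) - P(F)| ≤ P(F)`, `|N(T) - N(F)| ≤ N(F)`.
* `exists_smooth_nonneg_approx`: on a finite-dimensional real normed space with a measure finite
  on compacts, a measurable `0 ≤ T ≤ M` vanishing outside a ball is approximated in `L¹` by a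
  smooth `0 ≤ S ≤ M + 1` vanishing outside a slightly larger ball — smooth compactly supported
  approximation (`MeasureTheory.MemLp.exist_eLpNorm_sub_le`), a cut-off (`ContDiffBump`) and the
  clamp `σ`. This replaces mollification and keeps uniform `L^∞` control, so that the entropies of
  the approximants are controlled by the Lipschitz/Hölder estimates above (no Jensen inequality or
  uniform integrability is needed).

## References

* C. Cercignani, R. Illner, M. Pulvirenti, *The Mathematical Theory of Dilute Gases*, Springer
  (1994), §5.3 Step 7, pp. 146–147.
-/

open MeasureTheory Metric Real Set Filter Topology
open scoped ENNReal

noncomputable section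

namespace Literature.MathematicalPhysics.KineticTheory

/-! ## The two halves of the entropy function `u ↦ u log u`

`P(u) = u log⁺ u = u · max (log u) 0` (vanishing on `[0, 1]`, Lipschitz on bounded sets) and
`N(u) = u log⁻ u = u · max (-log u) 0` (vanishing on `[1, ∞)`, Hölder of exponent `½`), with
`u log u = P(u) - N(u)` and `u |log u| = P(u) + N(u)`. -/

section EntropyFunction

/-- `u log u = u log⁺ u - u log⁻ u`. [folklore] -/
theorem mul_log_eq_posPart_sub_negPart (u : ℝ) :
    u * log u = u * max (log u) 0 - u * max (-log u) 0 := by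
  rcases le_total 0 (log u) with h | h
  · rw [max_eq_left h, max_eq_right (by linarith), mul_zero, sub_zero]
  · rw [max_eq_right h, max_eq_left (by linarith), mul_zero, zero_sub, mul_neg, neg_neg]

/-- `u |log u| = u log⁺ u + u log⁻ u`. [folklore] -/
theorem mul_abs_log_eq_posPart_add_negPart (u : ℝ) :
    u * |log u| = u * max (log u) 0 + u * max (-log u) 0 := by
  rcases le_total 0 (log u) with h | h
  · rw [max_eq_left h, max_eq_right (by linarith), mul_zero, add_zero, abs_of_nonneg h]
  · rw [max_eq_right h, max_eq_left (by linarith), mul_zero, zero_add, abs_of_nonpos h, mul_neg]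

/-- On `[0, 1]`, `u log⁺ u = 0`. [folklore] -/
theorem posPart_entropy_eq_zero {u : ℝ} (h0 : 0 ≤ u) (h1 : u ≤ 1) : u * max (log u) 0 = 0 := by
  rw [max_eq_right (log_nonpos h0 h1), mul_zero]

/-- On `[1, ∞)`, `u log⁻ u = 0`. [folklore] -/
theorem negPart_entropy_eq_zero {u : ℝ} (h1 : 1 ≤ u) : u * max (-log u) 0 = 0 := by
  rw [max_eq_right (by linarith [log_nonneg h1]), mul_zero]

/-- On `[1, ∞)`, `u log⁺ u = u log u`. [folklore] -/
theorem posPart_entropy_eq_mul_log {u : ℝ} (h1 : 1 ≤ u) : u * max (log u) 0 = u * log u := by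
  rw [max_eq_left (log_nonneg h1)]

/-- On `[0, 1]`, `u log⁻ u = -(u log u)`. [folklore] -/
theorem negPart_entropy_eq_neg_mul_log {u : ℝ} (h0 : 0 ≤ u) (h1 : u ≤ 1) :
    u * max (-log u) 0 = -(u * log u) := by
  rw [max_eq_left (by linarith [log_nonpos h0 h1]), mul_neg]

/-- `u log⁺ u ≥ 0` for `u ≥ 0`. [folklore] -/
theorem posPart_entropy_nonneg {u : ℝ} (h0 : 0 ≤ u) : 0 ≤ u * max (log u) 0 :=
  mul_nonneg h0 (le_max_right _ _)

/-- `u log⁻ u ≥ 0` for `u ≥ 0`. [folklore] -/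
theorem negPart_entropy_nonneg {u : ℝ} (h0 : 0 ≤ u) : 0 ≤ u * max (-log u) 0 :=
  mul_nonneg h0 (le_max_right _ _)

/-- `u ↦ u log u` is nondecreasing on `[1, ∞)`. [folklore] -/
theorem monotoneOn_mul_log_Ici : MonotoneOn (fun u : ℝ => u * log u) (Ici 1) := by
  refine monotoneOn_of_deriv_nonneg (convex_Ici 1) Real.continuous_mul_log.continuousOn ?_ ?_
  · intro x hx
    rw [interior_Ici] at hx
    exact (Real.hasDerivAt_mul_log (by linarith [hx.out] : x ≠ 0)).differentiableAt.differentiableWithinAt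
  · intro x hx
    rw [interior_Ici] at hx
    rw [(Real.hasDerivAt_mul_log (by linarith [hx.out] : x ≠ 0)).deriv]
    linarith [log_nonneg hx.out.le]

/-- `u ↦ (1 + log M) u - u log u` is nondecreasing on `[1, M]`. [folklore] -/
theorem monotoneOn_lipschitz_aux (M : ℝ) :
    MonotoneOn (fun u : ℝ => (1 + log M) * u - u * log u) (Icc 1 M) := by
  refine monotoneOn_of_deriv_nonneg (convex_Icc 1 M)
    ((continuous_const.mul continuous_id).sub Real.continuous_mul_log).continuousOn ?_ ?_
  · intro x hx
    rw [interior_Icc] at hx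
    have hd : HasDerivAt (fun u : ℝ => (1 + log M) * u - u * log u)
        ((1 + log M) * 1 - (log x + 1)) x :=
      ((hasDerivAt_id x).const_mul _).sub (Real.hasDerivAt_mul_log (by linarith [hx.1] : x ≠ 0))
    exact hd.differentiableAt.differentiableWithinAt
  · intro x hx
    rw [interior_Icc] at hx
    have hd : HasDerivAt (fun u : ℝ => (1 + log M) * u - u * log u)
        ((1 + log M) * 1 - (log x + 1)) x :=
      ((hasDerivAt_id x).const_mul _).sub (Real.hasDerivAt_mul_log (by linarith [hx.1] : x ≠ 0))
    rw [hd.deriv]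
    linarith [log_le_log (by linarith [hx.1]) hx.2.le]

/-- **Lipschitz estimate for `u log⁺ u` on `[0, M]`** (`M ≥ 1`):
`|a log⁺ a - b log⁺ b| ≤ (1 + log M) |a - b|`. [folklore] -/
theorem abs_posPart_entropy_sub_le {M a b : ℝ} (hM : 1 ≤ M) (ha : a ∈ Icc 0 M) (hb : b ∈ Icc 0 M) :
    |a * max (log a) 0 - b * max (log b) 0| ≤ (1 + log M) * |a - b| := by
  have hL : 0 ≤ 1 + log M := by linarith [log_nonneg hM]
  -- reduce to `b ≤ a`
  wlog hba : b ≤ a generalizing a b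
  · have h := this hb ha (le_of_not_ge hba)
    rwa [abs_sub_comm, abs_sub_comm b a] at h
  rw [abs_of_nonneg (sub_nonneg.2 hba)]
  rcases le_or_gt a 1 with ha1 | ha1
  · -- both in `[0, 1]`
    rw [posPart_entropy_eq_zero ha.1 ha1, posPart_entropy_eq_zero hb.1 (hba.trans ha1), sub_zero,
      abs_zero]
    exact mul_nonneg hL (sub_nonneg.2 hba)
  · -- `a > 1`; replace `b` by `b' = max b 1 ∈ [1, a]`
    set b' : ℝ := max b 1 with hb'
    have hb'1 : 1 ≤ b' := le_max_right _ _
    have hb'a : b' ≤ a := max_le hba ha1.le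
    have hPb : b * max (log b) 0 = b' * log b' := by
      rcases le_total b 1 with h | h
      · rw [posPart_entropy_eq_zero hb.1 h, hb', max_eq_right h, log_one, mul_zero]
      · rw [hb', max_eq_left h, posPart_entropy_eq_mul_log h]
    rw [posPart_entropy_eq_mul_log ha1.le, hPb]
    have h1 : b' * log b' ≤ a * log a := monotoneOn_mul_log_Ici hb'1 (hb'1.trans hb'a) hb'a
    have h2 := monotoneOn_lipschitz_aux M ⟨hb'1, hb'a.trans ha.2⟩ ⟨hb'1.trans hb'a, ha.2⟩ hb'a
    simp only at h2
    rw [abs_of_nonneg (sub_nonneg.2 h1)]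
    have h3 : a - b' ≤ a - b := by linarith [le_max_left b 1]
    nlinarith [mul_le_mul_of_nonneg_left h3 hL]

/-- `|log x| < 2/√x` on `(0, 1]` (from `|log y · y| < 1` at `y = √x`). [folklore] -/
theorem abs_log_lt_two_div_sqrt {x : ℝ} (h0 : 0 < x) (h1 : x ≤ 1) : |log x| < 2 / Real.sqrt x := by
  have hs0 : 0 < Real.sqrt x := Real.sqrt_pos.2 h0
  have hs1 : Real.sqrt x ≤ 1 := by
    have := Real.sqrt_le_sqrt h1; rwa [Real.sqrt_one] at this
  have h := Real.abs_log_mul_self_lt (Real.sqrt x) hs0 hs1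
  rw [Real.log_sqrt h0.le, abs_mul, abs_of_pos hs0, abs_div, abs_two] at h
  rw [lt_div_iff₀ hs0]
  linarith

/-- `u ↦ 4√u + u log u` is nondecreasing on `[0, 1]`. [folklore] -/
theorem monotoneOn_four_sqrt_add_mul_log :
    MonotoneOn (fun u : ℝ => 4 * Real.sqrt u + u * log u) (Icc 0 1) := by
  refine monotoneOn_of_deriv_nonneg (convex_Icc 0 1)
    ((continuous_const.mul Real.continuous_sqrt).add Real.continuous_mul_log).continuousOn ?_ ?_
  · intro x hx
    rw [interior_Icc] at hx
    have hd : HasDerivAt (fun u : ℝ => 4 * Real.sqrt u + u * log u)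
        (4 * (1 / (2 * Real.sqrt x)) + (log x + 1)) x :=
      ((Real.hasDerivAt_sqrt hx.1.ne').const_mul 4).add (Real.hasDerivAt_mul_log hx.1.ne')
    exact hd.differentiableAt.differentiableWithinAt
  · intro x hx
    rw [interior_Icc] at hx
    have hd : HasDerivAt (fun u : ℝ => 4 * Real.sqrt u + u * log u)
        (4 * (1 / (2 * Real.sqrt x)) + (log x + 1)) x :=
      ((Real.hasDerivAt_sqrt hx.1.ne').const_mul 4).add (Real.hasDerivAt_mul_log hx.1.ne')
    rw [hd.deriv]
    have h := abs_log_lt_two_div_sqrt hx.1 hx.2.le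
    have hs0 : 0 < Real.sqrt x := Real.sqrt_pos.2 hx.1
    have hlog : -(2 / Real.sqrt x) < log x := by
      have := neg_abs_le (log x); linarith
    have : 4 * (1 / (2 * Real.sqrt x)) = 2 / Real.sqrt x := by field_simp; ring
    rw [this]
    linarith

/-- `u ↦ 4√u - u log u` is nondecreasing on `[0, 1]`. [folklore] -/
theorem monotoneOn_four_sqrt_sub_mul_log :
    MonotoneOn (fun u : ℝ => 4 * Real.sqrt u - u * log u) (Icc 0 1) := by
  refine monotoneOn_of_deriv_nonneg (convex_Icc 0 1)
    ((continuous_const.mul Real.continuous_sqrt).sub Real.continuous_mul_log).continuousOn ?_ ?_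
  · intro x hx
    rw [interior_Icc] at hx
    have hd : HasDerivAt (fun u : ℝ => 4 * Real.sqrt u - u * log u)
        (4 * (1 / (2 * Real.sqrt x)) - (log x + 1)) x :=
      ((Real.hasDerivAt_sqrt hx.1.ne').const_mul 4).sub (Real.hasDerivAt_mul_log hx.1.ne')
    exact hd.differentiableAt.differentiableWithinAt
  · intro x hx
    rw [interior_Icc] at hx
    have hd : HasDerivAt (fun u : ℝ => 4 * Real.sqrt u - u * log u)
        (4 * (1 / (2 * Real.sqrt x)) - (log x + 1)) x :=
      ((Real.hasDerivAt_sqrt hx.1.ne').const_mul 4).sub (Real.hasDerivAt_mul_log hx.1.ne')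
    rw [hd.deriv]
    have hs0 : 0 < Real.sqrt x := Real.sqrt_pos.2 hx.1
    have hs1 : Real.sqrt x ≤ 1 := by
      have := Real.sqrt_le_sqrt hx.2.le; rwa [Real.sqrt_one] at this
    have hlog : log x ≤ 0 := log_nonpos hx.1.le hx.2.le
    have h2 : 2 ≤ 2 / Real.sqrt x := by rw [le_div_iff₀ hs0]; nlinarith
    have : 4 * (1 / (2 * Real.sqrt x)) = 2 / Real.sqrt x := by field_simp; ring
    rw [this]
    linarith

/-- `√a - √b ≤ √(a - b)` for `0 ≤ b ≤ a`. [folklore] -/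
theorem sqrt_sub_sqrt_le_sqrt_sub {a b : ℝ} (hb : 0 ≤ b) (hba : b ≤ a) :
    Real.sqrt a - Real.sqrt b ≤ Real.sqrt (a - b) := by
  rw [sub_le_iff_le_add, Real.sqrt_le_left]
  · have h1 := Real.sq_sqrt (sub_nonneg.2 hba)
    have h2 := Real.sq_sqrt hb
    nlinarith [Real.sqrt_nonneg (a - b), Real.sqrt_nonneg b,
      mul_nonneg (Real.sqrt_nonneg (a - b)) (Real.sqrt_nonneg b)]
  · positivity

/-- **Hölder estimate for `u log⁻ u`**: for `a, b ≥ 0`,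
`|a log⁻ a - b log⁻ b| ≤ 4 √|a - b|`. [folklore] -/
theorem abs_negPart_entropy_sub_le {a b : ℝ} (ha : 0 ≤ a) (hb : 0 ≤ b) :
    |a * max (-log a) 0 - b * max (-log b) 0| ≤ 4 * Real.sqrt |a - b| := by
  wlog hba : b ≤ a generalizing a b
  · have h := this hb ha (le_of_not_ge hba)
    rwa [abs_sub_comm, abs_sub_comm b a] at h
  rw [abs_of_nonneg (sub_nonneg.2 hba)]
  -- the core estimate on `[0, 1]`
  have core : ∀ {a b : ℝ}, 0 ≤ b → b ≤ a → a ≤ 1 →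
      |a * max (-log a) 0 - b * max (-log b) 0| ≤ 4 * Real.sqrt (a - b) := by
    intro a b hb hba ha1
    have ha : 0 ≤ a := hb.trans hba
    rw [negPart_entropy_eq_neg_mul_log ha ha1, negPart_entropy_eq_neg_mul_log hb (hba.trans ha1)]
    have h1 := monotoneOn_four_sqrt_add_mul_log ⟨hb, hba.trans ha1⟩ ⟨ha, ha1⟩ hba
    have h2 := monotoneOn_four_sqrt_sub_mul_log ⟨hb, hba.trans ha1⟩ ⟨ha, ha1⟩ hba
    simp only at h1 h2
    have h3 := sqrt_sub_sqrt_le_sqrt_sub hb hba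
    rw [abs_le]
    constructor <;> nlinarith
  rcases le_or_gt a 1 with ha1 | ha1
  · exact core hb hba ha1
  · rw [negPart_entropy_eq_zero ha1.le, zero_sub, abs_neg]
    rcases le_or_gt b 1 with hb1 | hb1
    · have h := core hb hb1 le_rfl
      rw [negPart_entropy_eq_zero le_rfl, zero_sub, abs_neg] at h
      exact h.trans (mul_le_mul_of_nonneg_left (Real.sqrt_le_sqrt (by linarith)) (by norm_num))
    · rw [negPart_entropy_eq_zero hb1.le, abs_zero]
      positivity

/-- `u log⁺ u` is nondecreasing on `[0, ∞)`. [folklore] -/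
theorem posPart_entropy_mono {a b : ℝ} (hb : 0 ≤ b) (hba : b ≤ a) :
    b * max (log b) 0 ≤ a * max (log a) 0 := by
  rcases le_or_gt a 1 with ha1 | ha1
  · rw [posPart_entropy_eq_zero hb (hba.trans ha1), posPart_entropy_eq_zero (hb.trans hba) ha1]
  · rcases le_total b 1 with hb1 | hb1
    · rw [posPart_entropy_eq_zero hb hb1]
      exact posPart_entropy_nonneg (hb.trans hba)
    · rw [posPart_entropy_eq_mul_log hb1, posPart_entropy_eq_mul_log ha1.le]
      exact monotoneOn_mul_log_Ici hb1 (hb1.trans hba) hba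

/-- `u log⁻ u ≤ 4 √u` for `u ≥ 0`. [folklore] -/
theorem negPart_entropy_le_four_sqrt {u : ℝ} (hu : 0 ≤ u) : u * max (-log u) 0 ≤ 4 * Real.sqrt u := by
  have h := abs_negPart_entropy_sub_le hu le_rfl (b := 0)
  simp only [zero_mul, sub_zero] at h
  rw [abs_of_nonneg hu] at h
  exact (le_abs_self _).trans h

end EntropyFunction

/-! ## A smooth one-Lipschitz clamp -/

section Clamp

/-- **A smooth `1`-Lipschitz clamp.** For `0 < a ≤ M` there is a smooth `σ : ℝ → ℝ` with
`0 ≤ σ ≤ M + 1`, `σ = 0` on `(-∞, a/2]`, `|σ u - σ v| ≤ |u - v|`, and `|σ u - u| ≤ a` on `[0, M]`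
(a primitive of a product of `Real.smoothTransition`s which equals `1` on `[a, M]` and vanishes
off `(a/2, M + 1)`). Composing a smooth function with values approximating `[0, M]` with `σ` makes
it nonnegative, bounded by `M + 1` and supported where the function exceeds `a/2`, at an `L¹` cost
controlled by `a`. [folklore] -/
theorem exists_smooth_clamp {a M : ℝ} (ha : 0 < a) (haM : a ≤ M) :
    ∃ σ : ℝ → ℝ, ContDiff ℝ ((⊤ : ℕ∞) : WithTop ℕ∞) σ ∧ (∀ u, 0 ≤ σ u) ∧ (∀ u, σ u ≤ M + 1) ∧
      (∀ u ≤ a / 2, σ u = 0) ∧ (∀ u v, |σ u - σ v| ≤ |u - v|) ∧ ∀ u ∈ Icc 0 M, |σ u - u| ≤ a := by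
  -- the derivative `θ`
  set θ : ℝ → ℝ := fun w => Real.smoothTransition (2 * w / a - 1) * Real.smoothTransition (M + 1 - w)
    with hθ
  have hθc : ContDiff ℝ ((⊤ : ℕ∞) : WithTop ℕ∞) θ := by
    refine ContDiff.mul ?_ ?_
    · exact Real.smoothTransition.contDiff.comp (by fun_prop)
    · exact Real.smoothTransition.contDiff.comp (by fun_prop)
  have hθcont : Continuous θ := hθc.continuous
  have hθ0 : ∀ w, 0 ≤ θ w := fun w =>
    mul_nonneg (Real.smoothTransition.nonneg _) (Real.smoothTransition.nonneg _)
  have hθ1 : ∀ w, θ w ≤ 1 := fun w =>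
    mul_le_one₀ (Real.smoothTransition.le_one _) (Real.smoothTransition.nonneg _)
      (Real.smoothTransition.le_one _)
  have hθlow : ∀ w ≤ a / 2, θ w = 0 := by
    intro w hw
    have h1 : 2 * w / a - 1 ≤ 0 := by
      rw [sub_nonpos, div_le_one ha]; linarith
    simp only [hθ, Real.smoothTransition.zero_of_nonpos h1, zero_mul]
  have hθhigh : ∀ w, M + 1 ≤ w → θ w = 0 := by
    intro w hw
    simp only [hθ, Real.smoothTransition.zero_of_nonpos (by linarith : M + 1 - w ≤ 0), mul_zero]
  have hθmid : ∀ w ∈ Icc a M, θ w = 1 := by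
    intro w hw
    have h1 : 1 ≤ 2 * w / a - 1 := by
      rw [le_sub_iff_add_le, le_div_iff₀ ha]; linarith [hw.1]
    simp only [hθ, Real.smoothTransition.one_of_one_le h1,
      Real.smoothTransition.one_of_one_le (by linarith [hw.2] : (1 : ℝ) ≤ M + 1 - w), mul_one]
  have hθi : ∀ x y : ℝ, IntervalIntegrable θ volume x y := fun x y =>
    hθcont.intervalIntegrable x y
  -- the clamp `σ`
  set σ : ℝ → ℝ := fun u => ∫ w in (0 : ℝ)..u, θ w with hσ
  have hσd : ∀ u, HasDerivAt σ (θ u) u := fun u =>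
    (hθcont.integral_hasStrictDerivAt 0 u).hasDerivAt
  have hσderiv : deriv σ = θ := deriv_eq hσd
  have hσc : ContDiff ℝ ((⊤ : ℕ∞) : WithTop ℕ∞) σ := by
    rw [contDiff_infty_iff_deriv]
    exact ⟨fun u => (hσd u).differentiableAt, by rw [hσderiv]; exact hθc⟩
  -- `σ = 0` on `(-∞, a/2]`
  have hσlow : ∀ u ≤ a / 2, σ u = 0 := by
    intro u hu
    simp only [hσ]
    rw [intervalIntegral.integral_congr (g := fun _ => (0 : ℝ)) ?_, intervalIntegral.integral_zero]
    intro w hw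
    refine hθlow w ?_
    rcases le_total 0 u with h0 | h0
    · rw [uIcc_of_le h0] at hw; exact hw.2.trans hu
    · rw [uIcc_of_ge h0] at hw; exact hw.2.trans (by linarith)
  -- differences are integrals over the intermediate interval
  have hσsub : ∀ u v, σ u - σ v = ∫ w in v..u, θ w := fun u v =>
    intervalIntegral.integral_interval_sub_left (hθi 0 u) (hθi 0 v)
  have hlip : ∀ u v, |σ u - σ v| ≤ |u - v| := by
    intro u v
    rw [hσsub, ← Real.norm_eq_abs]
    have h := intervalIntegral.norm_integral_le_of_norm_le_const (a := v) (b := u) (C := 1)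
      (f := θ) fun w _ => by rw [Real.norm_eq_abs, abs_of_nonneg (hθ0 w)]; exact hθ1 w
    rwa [one_mul] at h
  -- nonnegativity
  have hσ0 : ∀ u, 0 ≤ σ u := by
    intro u
    rcases le_or_gt u (a / 2) with hu | hu
    · rw [hσlow u hu]
    · exact intervalIntegral.integral_nonneg (by linarith) fun w _ => hθ0 w
  -- `u - σ u = ∫₀ᵘ (1 - θ)`
  have hgap : ∀ u, u - σ u = ∫ w in (0 : ℝ)..u, (1 - θ w) := by
    intro u
    rw [intervalIntegral.integral_sub intervalIntegrable_const (hθi 0 u),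
      intervalIntegral.integral_const, smul_eq_mul, sub_zero, mul_one]
  -- the bound `σ ≤ M + 1`
  have hσle : ∀ u, σ u ≤ M + 1 := by
    intro u
    rcases le_or_gt u 0 with hu0 | hu0
    · rw [hσlow u (by linarith)]; linarith
    have hup : ∀ u, 0 ≤ u → σ u ≤ u := fun u hu => by
      have h : 0 ≤ ∫ w in (0 : ℝ)..u, (1 - θ w) :=
        intervalIntegral.integral_nonneg hu (fun w _ => sub_nonneg.2 (hθ1 w))
      rw [← hgap] at h
      linarith
    rcases le_or_gt u (M + 1) with hu1 | hu1
    · exact (hup u hu0.le).trans hu1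
    · have hsplit : σ u = σ (M + 1) + ∫ w in (M + 1)..u, θ w := by
        have := hσsub u (M + 1); linarith
      have hz : ∫ w in (M + 1)..u, θ w = 0 := by
        rw [intervalIntegral.integral_congr (g := fun _ => (0 : ℝ)) ?_, intervalIntegral.integral_zero]
        intro w hw
        rw [uIcc_of_le hu1.le] at hw
        exact hθhigh w hw.1
      rw [hsplit, hz, add_zero]
      exact hup (M + 1) (by linarith)
  -- the approximation `|σ u - u| ≤ a` on `[0, M]`
  have happrox : ∀ u ∈ Icc 0 M, |σ u - u| ≤ a := by
    intro u hu
    rw [abs_sub_comm, abs_of_nonneg]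
    swap
    · rw [hgap]; exact intervalIntegral.integral_nonneg hu.1 fun w _ => sub_nonneg.2 (hθ1 w)
    rcases le_or_gt u a with hua | hua
    · calc u - σ u ≤ u - 0 := by linarith [hσ0 u]
        _ ≤ a := by linarith
    · have h1i : ∀ x y : ℝ, IntervalIntegrable (fun w => 1 - θ w) volume x y := fun x y =>
        (continuous_const.sub hθcont).intervalIntegrable x y
      rw [hgap, ← intervalIntegral.integral_add_adjacent_intervals (h1i 0 a) (h1i a u)]
      have hz : ∫ w in a..u, (1 - θ w) = 0 := by
        rw [intervalIntegral.integral_congr (g := fun _ => (0 : ℝ)) ?_, intervalIntegral.integral_zero]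
        intro w hw
        rw [uIcc_of_le hua.le] at hw
        simp only [hθmid w ⟨hw.1, hw.2.trans hu.2⟩, sub_self]
      rw [hz, add_zero]
      calc ∫ w in (0 : ℝ)..a, (1 - θ w) ≤ ∫ _ in (0 : ℝ)..a, (1 : ℝ) :=
            intervalIntegral.integral_mono_on ha.le (h1i 0 a) intervalIntegrable_const
              fun w _ => by linarith [hθ0 w]
        _ = a := by rw [intervalIntegral.integral_const, smul_eq_mul, sub_zero, mul_one]
  exact ⟨σ, hσc, hσ0, hσle, hσlow, hlip, happrox⟩

end Clamp

/-! ## Truncations of a nonnegative integrable function -/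

section Truncation

variable {α : Type*} [MeasurableSpace α] {μ : Measure α}

omit [MeasurableSpace α] in
/-- The truncation `T_n F = min(F, n) · 1_{K}` of a nonnegative function lies in
`[0, min (F z) n]` at each point. [folklore] -/
theorem truncation_mem {F : α → ℝ} (hF0 : ∀ z, 0 ≤ F z) (K : Set α) (n : ℕ) (z : α) :
    0 ≤ K.indicator (fun z => min (F z) (n : ℝ)) z ∧
      K.indicator (fun z => min (F z) (n : ℝ)) z ≤ F z ∧
      K.indicator (fun z => min (F z) (n : ℝ)) z ≤ n := by
  by_cases hz : z ∈ K
  · rw [indicator_of_mem hz]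
    exact ⟨le_min (hF0 z) (Nat.cast_nonneg n), min_le_left _ _, min_le_right _ _⟩
  · rw [indicator_of_notMem hz]
    exact ⟨le_rfl, hF0 z, Nat.cast_nonneg n⟩

omit [MeasurableSpace α] in
/-- The truncation takes one of the values `0`, `F z`, or `n` with `n ≥ 1`. [folklore] -/
theorem truncation_cases (F : α → ℝ) (K : Set α) (n : ℕ) (z : α) :
    K.indicator (fun z => min (F z) (n : ℝ)) z = 0 ∨
      K.indicator (fun z => min (F z) (n : ℝ)) z = F z ∨
      (K.indicator (fun z => min (F z) (n : ℝ)) z = n ∧ (1 : ℝ) ≤ n ∧ (n : ℝ) ≤ F z) := by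
  by_cases hz : z ∈ K
  · rw [indicator_of_mem hz]
    rcases le_total (F z) n with h | h
    · exact Or.inr (Or.inl (min_eq_left h))
    · rcases Nat.eq_zero_or_pos n with hn | hn
      · left
        rw [min_eq_right h, hn, Nat.cast_zero]
      · exact Or.inr (Or.inr ⟨min_eq_right h, by exact_mod_cast hn, h⟩)
  · rw [indicator_of_notMem hz]
    exact Or.inl rfl

/-- The truncations are measurable. [folklore] -/
theorem measurable_truncation {F : α → ℝ} (hFm : Measurable F) {K : Set α} (hK : MeasurableSet K)
    (n : ℕ) : Measurable (K.indicator fun z => min (F z) (n : ℝ)) :=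
  (hFm.min measurable_const).indicator hK

omit [MeasurableSpace α] in
/-- The truncations eventually equal `F` at every point, for an increasing exhausting family of
sets. [folklore] -/
theorem eventually_truncation_eq {F : α → ℝ} {K : ℕ → Set α} (hKmono : Monotone K)
    (hKex : ∀ z, ∃ n, z ∈ K n) (z : α) :
    ∀ᶠ n : ℕ in atTop, (K n).indicator (fun z => min (F z) (n : ℝ)) z = F z := by
  obtain ⟨n₀, hn₀⟩ := hKex z
  obtain ⟨n₁, hn₁⟩ := exists_nat_ge (F z)
  filter_upwards [eventually_ge_atTop (max n₀ n₁)] with n hn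
  have hzn : z ∈ K n := hKmono ((le_max_left _ _).trans hn) hn₀
  rw [indicator_of_mem hzn, min_eq_left]
  exact hn₁.trans (by exact_mod_cast (le_max_right _ _).trans hn)

/-- **Dominated convergence for eventually stationary sequences**: if `gₙ(z) = g(z)` for all
large `n` (almost every `z`) and `|gₙ - g| ≤ D ∈ L¹`, then `∫ |gₙ - g| → 0` (used for the
truncations `T_n F` composed with the entropy functions and weights). [folklore] -/
theorem tendsto_integral_abs_sub_of_eventually_eq {g : ℕ → α → ℝ} {gl D : α → ℝ}
    (hgm : ∀ n, AEStronglyMeasurable (g n) μ) (hglm : AEStronglyMeasurable gl μ)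
    (hD : Integrable D μ) (hle : ∀ n, ∀ᵐ z ∂μ, |g n z - gl z| ≤ D z)
    (hev : ∀ᵐ z ∂μ, ∀ᶠ n : ℕ in atTop, g n z = gl z) :
    Tendsto (fun n => ∫ z, |g n z - gl z| ∂μ) atTop (𝓝 0) := by
  have h := tendsto_integral_of_dominated_convergence (μ := μ) D
    (F := fun n z => |g n z - gl z|) (f := fun _ => (0 : ℝ))
    (fun n => ((hgm n).sub hglm).norm.congr (Eventually.of_forall fun z => by
      simp only [Pi.sub_apply, Real.norm_eq_abs])) hD
    (fun n => (hle n).mono fun z hz => by rw [Real.norm_eq_abs, abs_abs]; exact hz)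
    (hev.mono fun z hz => ?_)
  · simpa using h
  · refine tendsto_const_nhds.congr' ?_
    filter_upwards [hz] with n hn
    rw [hn, sub_self, abs_zero]

omit [MeasurableSpace α] in
/-- Domination for the positive entropy part of the truncations:
`|P(T_n F z) - P(F z)| ≤ P(F z)`. [folklore] -/
theorem abs_posPart_entropy_truncation_sub_le {F : α → ℝ} (hF0 : ∀ z, 0 ≤ F z) (K : Set α)
    (n : ℕ) (z : α) :
    |K.indicator (fun z => min (F z) (n : ℝ)) z * max (log (K.indicator (fun z => min (F z) (n : ℝ)) z)) 0 -
        F z * max (log (F z)) 0| ≤ F z * max (log (F z)) 0 := by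
  obtain ⟨h0, hle, -⟩ := truncation_mem hF0 K n z
  have h1 := posPart_entropy_mono h0 hle
  have h2 := posPart_entropy_nonneg h0
  rw [abs_sub_comm, abs_of_nonneg (sub_nonneg.2 h1)]
  linarith

omit [MeasurableSpace α] in
/-- Domination for the negative entropy part of the truncations:
`|N(T_n F z) - N(F z)| ≤ N(F z)`. [folklore] -/
theorem abs_negPart_entropy_truncation_sub_le {F : α → ℝ} (hF0 : ∀ z, 0 ≤ F z) (K : Set α)
    (n : ℕ) (z : α) :
    |K.indicator (fun z => min (F z) (n : ℝ)) z * max (-log (K.indicator (fun z => min (F z) (n : ℝ)) z)) 0 -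
        F z * max (-log (F z)) 0| ≤ F z * max (-log (F z)) 0 := by
  have hN0 := negPart_entropy_nonneg (hF0 z)
  rcases truncation_cases F K n z with h | h | ⟨h, hn1, -⟩
  · rw [h, zero_mul, zero_sub, abs_neg, abs_of_nonneg hN0]
  · rw [h, sub_self, abs_zero]; exact hN0
  · rw [h, negPart_entropy_eq_zero hn1, zero_sub, abs_neg, abs_of_nonneg hN0]

end Truncation

/-! ## Smooth nonnegative approximation of a bounded compactly supported function -/

section SmoothApprox

variable {V : Type*} [NormedAddCommGroup V] [NormedSpace ℝ V] [FiniteDimensional ℝ V]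
  [MeasurableSpace V] [BorelSpace V]

/-- **Smooth, nonnegative, bounded approximation in `L¹`.** Let `0 ≤ T ≤ M` (`M ≥ 1`) be
measurable and vanish outside the closed ball of radius `R > 0`, and let `η > 0`. Then there is a
smooth `S` with `0 ≤ S ≤ M + 1`, vanishing outside the ball of radius `R + 1`, with
`∫ |S - T| dμ ≤ η`. Construction: a smooth compactly supported `g` with `‖T - g‖_{L¹}` small
(`MeasureTheory.MemLp.exist_eLpNorm_sub_le`), a cut-off `χ` (`ContDiffBump`) and the smooth
`1`-Lipschitz clamp `σ` of `exists_smooth_clamp`: `S = σ ∘ (χ g)`. [folklore] -/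
theorem exists_smooth_nonneg_approx (μ : Measure V) [IsFiniteMeasureOnCompacts μ]
    {T : V → ℝ} (hTm : Measurable T) {M : ℝ} (hM : 1 ≤ M) (hT0 : ∀ z, 0 ≤ T z)
    (hTM : ∀ z, T z ≤ M) {R : ℝ} (hR : 0 < R) (hTsupp : ∀ z, R < ‖z‖ → T z = 0) {η : ℝ}
    (hη : 0 < η) :
    ∃ S : V → ℝ, ContDiff ℝ ((⊤ : ℕ∞) : WithTop ℕ∞) S ∧ HasCompactSupport S ∧ (∀ z, 0 ≤ S z) ∧
      (∀ z, S z ≤ M + 1) ∧ (∀ z, R + 1 ≤ ‖z‖ → S z = 0) ∧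
      Integrable (fun z => S z - T z) μ ∧ ∫ z, |S z - T z| ∂μ ≤ η := by
  -- `T` is integrable
  have hTsup : Function.support T ⊆ closedBall (0 : V) R := by
    intro z hz
    rw [mem_closedBall, dist_zero_right]
    by_contra h
    exact hz (hTsupp z (lt_of_not_ge h))
  have hTi : Integrable T μ := by
    rw [← integrableOn_iff_integrable_of_support_subset hTsup]
    refine Measure.integrableOn_of_bounded (M := M) (measure_closedBall_lt_top).ne
      hTm.aestronglyMeasurable (Eventually.of_forall fun z => ?_)
    rw [Real.norm_eq_abs, abs_of_nonneg (hT0 z)]; exact hTM z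
  -- a smooth compactly supported `g` with `∫ |T - g| ≤ η / 2`
  have hη2 : 0 < η / 2 := half_pos hη
  obtain ⟨g, hgc, hgs, hgn⟩ := (memLp_one_iff_integrable.2 hTi).exist_eLpNorm_sub_le
    ENNReal.one_ne_top le_rfl hη2
  have hgi : Integrable g μ := hgs.continuous.integrable_of_hasCompactSupport hgc
  have hTg : ∫ z, |T z - g z| ∂μ ≤ η / 2 := by
    have h1 : ∫ z, |T z - g z| ∂μ = (eLpNorm (T - g) 1 μ).toReal := by
      rw [eLpNorm_one_eq_lintegral_enorm,
        ← integral_norm_eq_lintegral_enorm (hTi.sub hgi).aestronglyMeasurable]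
      rfl
    rw [h1]
    exact ENNReal.toReal_le_of_le_ofReal hη2.le hgn
  -- the cut-off
  let χ : ContDiffBump (0 : V) := ⟨R + 1 / 4, R + 1 / 2, by linarith, by linarith⟩
  have hrIn : χ.rIn = R + 1 / 4 := rfl
  have hrOut : χ.rOut = R + 1 / 2 := rfl
  set g₁ : V → ℝ := fun z => χ z * g z with hg₁
  have hg₁s : ContDiff ℝ ((⊤ : ℕ∞) : WithTop ℕ∞) g₁ := χ.contDiff.mul hgs
  have hg₁c : HasCompactSupport g₁ := χ.hasCompactSupport.mul_right
  have hg₁cont : Continuous g₁ := hg₁s.continuous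
  have hg₁zero : ∀ z, R + 1 / 2 ≤ ‖z‖ → g₁ z = 0 := by
    intro z hz
    have : χ z = 0 := by
      have hz' : z ∉ Function.support (χ : V → ℝ) := by
        rw [χ.support_eq, mem_ball, dist_zero_right, not_lt, hrOut]
        linarith
      simpa [Function.mem_support] using hz'
    simp only [hg₁, this, zero_mul]
  have hTg₁ : ∀ z, |T z - g₁ z| ≤ |T z - g z| := by
    intro z
    by_cases hz : z ∈ closedBall (0 : V) R
    · have : χ z = 1 := χ.one_of_mem_closedBall (by
        rw [mem_closedBall, dist_zero_right] at hz ⊢; rw [hrIn]; linarith)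
      simp only [hg₁, this, one_mul]; exact le_rfl
    · have hTz : T z = 0 := by
        rw [mem_closedBall, dist_zero_right, not_le] at hz
        exact hTsupp z hz
      rw [hTz, zero_sub, zero_sub, abs_neg, abs_neg, hg₁]
      simp only
      rw [abs_mul, abs_of_nonneg (χ.nonneg)]
      exact mul_le_of_le_one_left (abs_nonneg _) χ.le_one
  -- the clamp
  set m : ℝ := (μ (closedBall (0 : V) R)).toReal with hm
  have hm0 : 0 ≤ m := ENNReal.toReal_nonneg
  set a : ℝ := min 1 (η / (2 * (m + 1))) with ha
  have ha0 : 0 < a := lt_min one_pos (by positivity)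
  have ha1 : a ≤ 1 := min_le_left _ _
  have haη : a * m ≤ η / 2 := by
    have h1 : a ≤ η / (2 * (m + 1)) := min_le_right _ _
    calc a * m ≤ η / (2 * (m + 1)) * m := mul_le_mul_of_nonneg_right h1 hm0
      _ ≤ η / (2 * (m + 1)) * (m + 1) := by gcongr; linarith
      _ = η / 2 := by field_simp
  obtain ⟨σ, hσc, hσ0, hσM, hσlow, hσlip, hσapp⟩ := exists_smooth_clamp ha0 (ha1.trans hM)
  have hσzero : σ 0 = 0 := hσlow 0 (by linarith)
  -- the approximant
  refine ⟨fun z => σ (g₁ z), hσc.comp hg₁s, hg₁c.comp_left hσzero, fun z => hσ0 _, fun z => hσM _,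
    fun z hz => ?_, ?_, ?_⟩
  · show σ (g₁ z) = 0
    rw [hg₁zero z (by linarith), hσzero]
  · exact ((hσc.continuous.comp hg₁cont).integrable_of_hasCompactSupport
      (hg₁c.comp_left hσzero)).sub hTi
  · -- `|σ(g₁) - T| ≤ |g₁ - T| + a 1_{B_R}`
    have hpt : ∀ z, |σ (g₁ z) - T z| ≤
        |T z - g z| + (closedBall (0 : V) R).indicator (fun _ => a) z := by
      intro z
      have h1 : |σ (g₁ z) - σ (T z)| ≤ |T z - g z| :=
        calc |σ (g₁ z) - σ (T z)| ≤ |g₁ z - T z| := hσlip _ _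
          _ = |T z - g₁ z| := abs_sub_comm _ _
          _ ≤ |T z - g z| := hTg₁ z
      by_cases hz : z ∈ closedBall (0 : V) R
      · rw [indicator_of_mem hz]
        have h2 : |σ (T z) - T z| ≤ a := hσapp (T z) ⟨hT0 z, hTM z⟩
        calc |σ (g₁ z) - T z| = |(σ (g₁ z) - σ (T z)) + (σ (T z) - T z)| := by ring_nf
          _ ≤ |σ (g₁ z) - σ (T z)| + |σ (T z) - T z| := abs_add_le _ _
          _ ≤ |T z - g z| + a := add_le_add h1 h2
      · rw [indicator_of_notMem hz, add_zero]
        have hTz : T z = 0 := by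
          rw [mem_closedBall, dist_zero_right, not_le] at hz
          exact hTsupp z hz
        rw [hTz, hσzero, sub_zero] at h1
        rw [hTz, sub_zero]
        exact h1
    have hind : Integrable ((closedBall (0 : V) R).indicator fun _ => a) μ :=
      (integrableOn_const (measure_closedBall_lt_top (x := (0 : V)) (r := R)).ne).integrable_indicator
        measurableSet_closedBall
    have habs : Integrable (fun z => |T z - g z|) μ := (hTi.sub hgi).abs
    calc ∫ z, |σ (g₁ z) - T z| ∂μ
        ≤ ∫ z, (|T z - g z| + (closedBall (0 : V) R).indicator (fun _ => a) z) ∂μ := by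
          refine integral_mono_of_nonneg (Eventually.of_forall fun z => abs_nonneg _)
            (habs.add hind) (Eventually.of_forall hpt)
      _ = ∫ z, |T z - g z| ∂μ + a * m := by
          rw [integral_add habs hind, integral_indicator_const _ measurableSet_closedBall,
            smul_eq_mul, measureReal_def, ← hm, mul_comm]
      _ ≤ η / 2 + η / 2 := add_le_add hTg haη
      _ = η := add_halves η

end SmoothApprox

end Literature.MathematicalPhysics.KineticTheory
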